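import Literature.Computability.AlgebraicComplexity.AlmanLi2026FreeLunchSpeedup
import Literature.Computability.AlgebraicComplexity.AlmanLi2026AppendSlice
import Literature.Computability.AlgebraicComplexity.AlmanLi2026OneSliceRankCount
import Literature.LinearAlgebra.Matrix.CrossInterpolation
import HarnessLib

/-!
# The one-functional speedup `T ⊕ ⟨1, q+s−n−m, 1⟩ ⊴ S ⊕ ⟨1,s,1⟩` and Thm. 6.1 for rank decompositions (Alman–Li 2026, §5.3 / §6)

Topic `Literature/Computability/AlgebraicComplexity` (family `MatrixMultiplication`). Source: J. Alman,
B. Li, *Asymptotic Rank Speedup Theorems, Revisited*, arXiv:2605.21738 (2026): Thm. 5.1 (free-lunch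
speedup), Prop. 5.3 (rank count for one functional), Prop. 5.4 (appending a slice) and Thm. 6.1
(one-slice speedup for nonminimal border rank) with its one-line proof "The hypothesis exactly matches
the condition of (prop:add_slice). Applying that result, all the degeneration parameters align:
`T ⊕ ⟨1, r + s − 2n, 1⟩ ⊴ ⟨r⟩ ⊕ ⟨1, s, 1⟩`" (held text `paper:arxiv-2605.21738`, p0012–p0015).

This file is the COMBINATION of the three companion files (`AlmanLi2026FreeLunchSpeedup`:
`AlmanLi2026.thm51`; `AlmanLi2026AppendSlice`: `prop54_restriction`, `prop54_annihilates`,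
`prop54_contraction`; `AlmanLi2026OneSliceRankCount`: `prop53_rank`,
`restrictsTo_oneSlice_of_flattening_rank_eq`, `mem_ker_annihilatorA_iff`, `mem_ker_annihilatorB_iff`),
in the same coordinates (tensors `ι → κ → μ → K`, restriction data `A : ι' → ι → K` with `n = |ι'|`,
`B : κ' → κ → K` with `m = |κ'|`, `C : μ' → μ → K`; the slice `⟨1,s,1⟩` with trivial factor THIRD is
`rotate (oneSliceTensor K (Fin s))`).

## Statements

* `AlmanLi2026.oneFunctional_speedup` — **Props. 5.4 + 5.3 + Thm. 5.1 chained** (the argument of the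
  proof of Thm. 6.1, for RESTRICTION data over a field): if `T = (A ⊗ B ⊗ C) S` and `f : μ → K` is
  any functional with `q = rank (id ⊗ id ⊗ f) S` and `rank (A ⊗ B ⊗ f) S ≤ s`, then
  `T ⊕ ⟨1, q + s − (n + m), 1⟩ ⊴ S ⊕ ⟨1,s,1⟩` (truncated subtraction in `ℕ`).
  Proof as printed: factor `M = (A ⊗ B ⊗ f) S = P Qᵀ` through `K^s` (tree
  `exists_eq_mul_transpose_of_rank_le`), extend the restriction to `S ⊕ ⟨1,s,1⟩` by
  `(A P) ⊗ (B Q) ⊗ (C 0)` (Prop. 5.4), take `f' = (f, −1)`, which annihilates (Prop. 5.4) and whose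
  contraction `(id ⊗ id ⊗ f')(S ⊕ ⟨1,s,1⟩) = M_f ⊕ (−1_s)` has rank `q + s` (Prop. 5.4 "`r = q + s`";
  Guttman/Horn–Johnson block rank, tree `rank_fromBlocks_eq_card_add_rank_schur`), choose bases
  `A''`, `B''` of the two annihilators of Thm. 5.1 (`Module.finBasis` of the kernels), apply Thm. 5.1
  (`T ⊕ T'' ⊴ S ⊕ ⟨1,s,1⟩`) and Prop. 5.3 (`T'' ≅ ⟨1,t,1⟩`, `t ≥ (q+s) − n − m`), and shrink the slice.
* `AlmanLi2026.thm61_rankDecomposition` — **Thm. 6.1 in the `λ`-free case**: for a RANK decomposition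
  `T = ∑_{i<r} aᵢ ⊗ bᵢ ⊗ cᵢ` (so `T ≤ ⟨r⟩`) and nonzero scalars `c'ᵢ ∈ K` with
  `rank (∑ᵢ c'ᵢ aᵢ bᵢᵀ) ≤ s`: `T ⊕ ⟨1, r + s − (n + m), 1⟩ ⊴ ⟨r⟩ ⊕ ⟨1,s,1⟩` (printed for `n × n × n`:
  `r + s − 2n`).  The printed theorem is stated for BORDER-rank decompositions over `𝔽(λ)`; a rank
  decomposition is the special case of `λ`-free data, which is what is proved here.
  -- TODO(general form): border-rank data (`𝔽(λ)`-vectors `aᵢ, bᵢ, cᵢ`, `c'ᵢ ∈ 𝔽(λ) ∖ {0}`), i.e.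
  -- the kernels of Thm. 5.1 over `𝔽(λ)` with order bookkeeping (Cor. 5.1 is in the tree as
  -- `AlmanLi2026.cor51`; the missing piece is Prop. 5.3 over `𝔽(λ)`), and the asymptotic-rank clause
  -- `R̃(T) ≤ r + s^{2/3} − (r+s−2n)^{2/3}` (needs the three directions; tree `AlmanLi2026.prop45`).

No new definitions, no named facts.

## References

* J. Alman, B. Li, *Asymptotic Rank Speedup Theorems, Revisited*, arXiv:2605.21738 (2026), Thm. 5.1,
  Props. 5.3–5.4 (p0012–p0014), Thm. 6.1 (p0015). [AlmanLi2026]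
* R. A. Horn, C. R. Johnson, *Matrix Analysis*, 2nd ed. (2013), §0.4.5 (c), §0.8.5, §0.9.2 (rank of
  products and of block matrices; tree files `Literature/LinearAlgebra/Matrix/RankInequalities.lean`,
  `CrossInterpolation.lean`). [HornJohnson2013]
-/

noncomputable section

open scoped BigOperators Matrix

namespace Literature.Computability.AlgebraicComplexity

universe u

variable {K : Type u}
variable {ι κ μ ι' κ' μ' σ : Type*}

namespace AlmanLi2026

/-! ## Small tools -/

/-- A triple sum against the unit tensor collapses to the diagonal. [folklore] -/
private theorem sum_unitTensor_eq [CommSemiring K] {r : ℕ} (F G H : Fin r → K) :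
    (∑ a, ∑ b, ∑ c, F a * G b * H c * unitTensor K r a b c) = ∑ i, F i * G i * H i := by
  refine Finset.sum_congr rfl fun i _ => ?_
  rw [Finset.sum_eq_single i (fun j _ hj => by simp [Ne.symm hj]) (by simp),
    Finset.sum_eq_single i (fun k _ hk => by simp [Ne.symm hk]) (by simp)]
  simp

/-- `⟨1,t,1⟩ ≥ ⟨1,t₀,1⟩` for `t₀ ≤ t` (trivial factor third): zero out coordinates.
[cite: AlmanLi2026, §5.4] -/
theorem tensorRestrictsTo_rotate_oneSliceTensor_of_le [CommSemiring K] {t₀ t : ℕ} (h : t₀ ≤ t) :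
    TensorRestrictsTo (rotate (oneSliceTensor K (Fin t))) (rotate (oneSliceTensor K (Fin t₀))) := by
  have e : rotate (oneSliceTensor K (Fin t₀)) =
      fun x y z => rotate (oneSliceTensor K (Fin t)) (Fin.castLE h x) (Fin.castLE h y) (id z) := by
    funext x y z
    simp [rotate_apply, oneSliceTensor_apply, (Fin.castLE_injective h).eq_iff]
  rw [e]
  exact tensorRestrictsTo_precomp _ _ _ _

/-- The contraction `(id ⊗ id ⊗ f')(S ⊕ ⟨1,s,1⟩)`, `f' = (f, −1)`, is the block-diagonal matrix
`M_f ⊕ (−1_σ)` (Prop. 5.4: "the direct sum of the matrices `(id_U ⊗ id_V ⊗ f)S` and `⟨1,s,1⟩`").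
[cite: AlmanLi2026, Prop. 5.4 (proof)] -/
theorem contraction_eq_fromBlocks [CommRing K] [Fintype ι] [Fintype κ] [Fintype μ] [Fintype σ]
    [DecidableEq σ] (S : ι → κ → μ → K) (f : μ → K) :
    (Matrix.of fun (x : ι ⊕ σ) (y : κ ⊕ σ) => ∑ w, Sum.elim f (fun _ : Unit => (-1 : K)) w *
        directSumTensor S (rotate (oneSliceTensor K σ)) x y w) =
      Matrix.fromBlocks (Matrix.of fun a b => ∑ c, f c * S a b c) 0 0 (-1 : Matrix σ σ K) := by
  ext x y
  rw [Matrix.of_apply, prop54_contraction S f x y]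
  rcases x with a | i <;> rcases y with b | j
  · simp
  · simp
  · simp
  · simp only [Sum.elim_inr, Matrix.fromBlocks_apply₂₂, Matrix.neg_apply, Matrix.one_apply]
    split_ifs <;> simp

/-- `rank (M ⊕ (−1_σ)) = rank M + |σ|` ("which has rank `r = q + s`"; block rank, Horn–Johnson
§0.8.5/§0.9.2 via the tree's Guttman additivity). [cite: AlmanLi2026, Prop. 5.4 (proof)] -/
theorem rank_fromBlocks_neg_one [Field K] [Fintype ι] [Fintype κ] [Fintype σ] [DecidableEq σ]
    (M : Matrix ι κ K) :
    (Matrix.fromBlocks M 0 0 (-1 : Matrix σ σ K)).rank = M.rank + Fintype.card σ := by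
  have hswap : Matrix.fromBlocks M 0 0 (-1 : Matrix σ σ K) =
      (Matrix.fromBlocks (-1 : Matrix σ σ K) 0 0 M).submatrix Sum.swap Sum.swap := by
    rw [Matrix.fromBlocks_submatrix_sum_swap_sum_swap]
  have hunit : IsUnit (-1 : Matrix σ σ K).det := by
    rw [Matrix.det_neg, Matrix.det_one, mul_one]
    exact (isUnit_one.neg).pow _
  rw [hswap, show (Sum.swap : κ ⊕ σ → σ ⊕ κ) = (Equiv.sumComm κ σ) from rfl,
    show (Sum.swap : ι ⊕ σ → σ ⊕ ι) = (Equiv.sumComm ι σ) from rfl, Matrix.rank_submatrix,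
    Literature.LinearAlgebra.Matrix.rank_fromBlocks_eq_card_add_rank_schur _ _ _ _ hunit,
    Matrix.zero_mul, Matrix.zero_mul, sub_zero, add_comm]

/-! ## The one-functional speedup (Props. 5.4 + 5.3 + Thm. 5.1) -/

/-- **Alman–Li 2026, the one-functional speedup for restriction data** (Prop. 5.4 + Prop. 5.3 +
Thm. 5.1, the chain invoked in the proof of Thm. 6.1): let `T = (A ⊗ B ⊗ C) S` over a field, with
`n = |ι'|` rows of `A` and `m = |κ'|` rows of `B`, and let `f : μ → K` be any functional with
`q = rank (id ⊗ id ⊗ f) S` and `rank (A ⊗ B ⊗ f) S ≤ s`. Then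
`T ⊕ ⟨1, q + s − (n + m), 1⟩ ⊴ S ⊕ ⟨1, s, 1⟩`.
[cite: AlmanLi2026, Prop. 5.4 with Prop. 5.3 and Thm. 5.1 (proof of Thm. 6.1)] -/
theorem oneFunctional_speedup [Field K] [Fintype ι] [Fintype κ] [Fintype μ] [Fintype ι']
    [Fintype κ'] [Fintype μ'] [DecidableEq ι'] [DecidableEq κ'] [DecidableEq μ']
    {S : ι → κ → μ → K} {T : ι' → κ' → μ' → K} {A : ι' → ι → K} {B : κ' → κ → K}
    {C₀ : μ' → μ → K}
    (hT : ∀ a' b' c', T a' b' c' = ∑ a, ∑ b, ∑ c, A a' a * B b' b * C₀ c' c * S a b c)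
    (f : μ → K) {s : ℕ}
    (hs : (Matrix.of fun a' b' => ∑ a, ∑ b, ∑ c, A a' a * B b' b * f c * S a b c).rank ≤ s) :
    AlgDegeneratesTo (directSumTensor S (rotate (oneSliceTensor K (Fin s))))
      (directSumTensor T (rotate (oneSliceTensor K
        (Fin ((Matrix.of fun a b => ∑ c, f c * S a b c).rank + s -
          (Fintype.card ι' + Fintype.card κ')))))) := by
  classical
  -- Prop. 5.4: factor `M = (A ⊗ B ⊗ f) S = P Qᵀ` through `K^s`
  obtain ⟨P, Q, hPQ⟩ := Literature.LinearAlgebra.Matrix.exists_eq_mul_transpose_of_rank_le _ hs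
  have hM : ∀ a' b', (∑ a, ∑ b, ∑ c, A a' a * B b' b * f c * S a b c) = ∑ i, P a' i * Q b' i := by
    intro a' b'
    have h := congrFun (congrFun hPQ a') b'
    simpa only [Matrix.of_apply, Matrix.mul_apply, Matrix.transpose_apply] using h
  -- the extended data on `S' = S ⊕ ⟨1,s,1⟩`
  set S' : ι ⊕ Fin s → κ ⊕ Fin s → μ ⊕ Unit → K :=
    directSumTensor S (rotate (oneSliceTensor K (Fin s))) with hS'
  set Ae : ι' → ι ⊕ Fin s → K := fun a' => Sum.elim (A a') (P a') with hAe
  set Be : κ' → κ ⊕ Fin s → K := fun b' => Sum.elim (B b') (Q b') with hBe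
  set f' : μ ⊕ Unit → K := Sum.elim f (fun _ : Unit => (-1 : K)) with hf'
  -- Thm. 5.1's annihilators for the data `(Ae, Be, f')`, with bases as rows
  set VA := LinearMap.ker (Matrix.of fun (b' : κ') (x : ι ⊕ Fin s) =>
    ∑ y, ∑ w, Be b' y * f' w * S' x y w).mulVecLin with hVA
  set VB := LinearMap.ker (Matrix.of fun (a' : ι') (y : κ ⊕ Fin s) =>
    ∑ x, ∑ w, Ae a' x * f' w * S' x y w).mulVecLin with hVB
  set bA := Module.finBasis K VA
  set bB := Module.finBasis K VB
  set A'' : Fin (Module.finrank K VA) → ι ⊕ Fin s → K := fun x => ((bA x : VA) : ι ⊕ Fin s → K)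
    with hA''
  set B'' : Fin (Module.finrank K VB) → κ ⊕ Fin s → K := fun y => ((bB y : VB) : κ ⊕ Fin s → K)
    with hB''
  set T'' : Fin (Module.finrank K VA) → Fin (Module.finrank K VB) → Unit → K :=
    fun x y _ => ∑ a, ∑ b, ∑ c, A'' x a * B'' y b * f' c * S' a b c with hT''
  -- rows of `A''`, `B''` lie in the annihilators (Thm. 5.1's `hA'`, `hB'`)
  have hA''mem : ∀ x b' (z : Unit),
      (∑ a, ∑ b, ∑ c, A'' x a * Be b' b * (fun _ : Unit => f') z c * S' a b c) = 0 := by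
    intro x b' z
    exact (mem_ker_annihilatorA_iff S' Be f' (A'' x)).1 (bA x).2 b'
  have hB''mem : ∀ a' y (z : Unit),
      (∑ a, ∑ b, ∑ c, Ae a' a * B'' y b * (fun _ : Unit => f') z c * S' a b c) = 0 := by
    intro a' y z
    exact (mem_ker_annihilatorB_iff S' Ae f' (B'' y)).1 (bB y).2 a'
  -- and span them (Prop. 5.3's `hA'`, `hB'`)
  have hA''span : ∀ u : ι ⊕ Fin s → K,
      (∀ b', (∑ a, ∑ b, ∑ c, u a * Be b' b * f' c * S' a b c) = 0) →
        u ∈ Submodule.span K (Set.range A'') := by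
    intro u hu
    have hmem : u ∈ VA := (mem_ker_annihilatorA_iff S' Be f' u).2 hu
    have hspan : Submodule.span K (Set.range A'') = VA := by
      have h := congrArg (Submodule.map VA.subtype) bA.span_eq
      rwa [Submodule.map_span, ← Set.range_comp, Submodule.map_subtype_top] at h
    rw [hspan]
    exact hmem
  have hB''span : ∀ v : κ ⊕ Fin s → K,
      (∀ a', (∑ a, ∑ b, ∑ c, Ae a' a * v b * f' c * S' a b c) = 0) →
        v ∈ Submodule.span K (Set.range B'') := by
    intro v hv
    have hmem : v ∈ VB := (mem_ker_annihilatorB_iff S' Ae f' v).2 hv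
    have hspan : Submodule.span K (Set.range B'') = VB := by
      have h := congrArg (Submodule.map VB.subtype) bB.span_eq
      rwa [Submodule.map_span, ← Set.range_comp, Submodule.map_subtype_top] at h
    rw [hspan]
    exact hmem
  -- Thm. 5.1: `T ⊕ T'' ⊴ S'`
  have hdeg : AlgDegeneratesTo S' (directSumTensor T T'') :=
    thm51 (A := Ae) (B := Be) (C₀ := fun c' => Sum.elim (C₀ c') (fun _ => (0 : K)))
      (C' := fun _ : Unit => f')
      (fun a' b' c' => prop54_restriction P Q hT a' b' c') (fun x y z => by rw [hT''])
      (fun a' b' z => prop54_annihilates hM a' b' z) hA''mem hB''mem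
  -- Prop. 5.3: the matrix of `T''` has rank `t ≥ (q + s) − n − m`
  have hrank := prop53_rank (T' := T'') (fun x y z => by rw [hT'']) hA''span hB''span
  have hq : (Matrix.of fun (x : ι ⊕ Fin s) (y : κ ⊕ Fin s) => ∑ w, f' w * S' x y w).rank =
      (Matrix.of fun a b => ∑ c, f c * S a b c).rank + s := by
    rw [hf', hS', contraction_eq_fromBlocks, rank_fromBlocks_neg_one, Fintype.card_fin]
  rw [hq] at hrank
  -- `T'' ≅ ⟨1,t,1⟩ ≥ ⟨1, q+s-(n+m), 1⟩`
  have hslice := (restrictsTo_oneSlice_of_flattening_rank_eq T'' rfl).trans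
    (tensorRestrictsTo_rotate_oneSliceTensor_of_le (K := K)
      (t := (Matrix.of fun x y => T'' x y ()).rank)
      (t₀ := (Matrix.of fun a b => ∑ c, f c * S a b c).rank + s -
        (Fintype.card ι' + Fintype.card κ')) (by omega))
  exact hdeg.trans_restrictsTo ((TensorRestrictsTo.refl T).directSum hslice)

/-! ## Thm. 6.1 for rank decompositions -/

/-- **Alman–Li 2026, Thm. 6.1, `λ`-free case (rank decompositions).** Let
`T = ∑_{i<r} aᵢ ⊗ bᵢ ⊗ cᵢ` (columns of `A`, `B`, `C`; so `T ≤ ⟨r⟩`), with `n = |ι'|`, `m = |κ'|`, and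
let `c'ᵢ ∈ K` be NONZERO scalars such that `M = ∑ᵢ c'ᵢ aᵢ bᵢᵀ` has rank at most `s`. Then
`T ⊕ ⟨1, r + s − (n + m), 1⟩ ⊴ ⟨r⟩ ⊕ ⟨1, s, 1⟩` (printed, `n × n × n`: `⟨1, r + s − 2n, 1⟩`).
The printed theorem allows border-rank data over `𝔽(λ)`; this is its special case of `λ`-free data.
[cite: AlmanLi2026, Thm. 6.1 (rank-decomposition case)] -/
theorem thm61_rankDecomposition [Field K] [Fintype ι'] [Fintype κ'] [Fintype μ'] [DecidableEq ι']
    [DecidableEq κ'] [DecidableEq μ'] {r : ℕ} {T : ι' → κ' → μ' → K} {A : ι' → Fin r → K}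
    {B : κ' → Fin r → K} {C₀ : μ' → Fin r → K}
    (hT : ∀ a' b' c', T a' b' c' = ∑ i, A a' i * B b' i * C₀ c' i)
    {c' : Fin r → K} (hc' : ∀ i, c' i ≠ 0) {s : ℕ}
    (hM : (Matrix.of fun a' b' => ∑ i, A a' i * B b' i * c' i).rank ≤ s) :
    AlgDegeneratesTo (directSumTensor (unitTensor K r) (rotate (oneSliceTensor K (Fin s))))
      (directSumTensor T (rotate (oneSliceTensor K
        (Fin (r + s - (Fintype.card ι' + Fintype.card κ')))))) := by
  classical
  -- `T ≤ ⟨r⟩` with the data `(A, B, C)`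
  have hT' : ∀ a' b' c', T a' b' c' =
      ∑ a, ∑ b, ∑ c, A a' a * B b' b * C₀ c' c * unitTensor K r a b c := fun a' b' c' => by
    rw [sum_unitTensor_eq, hT]
  -- `(A ⊗ B ⊗ c') ⟨r⟩ = ∑ᵢ c'ᵢ aᵢ bᵢᵀ`
  have hs : (Matrix.of fun a' b' => ∑ a, ∑ b, ∑ c,
      A a' a * B b' b * c' c * unitTensor K r a b c).rank ≤ s := by
    have e : (Matrix.of fun a' b' => ∑ a, ∑ b, ∑ c, A a' a * B b' b * c' c * unitTensor K r a b c)
        = Matrix.of fun a' b' => ∑ i, A a' i * B b' i * c' i := by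
      ext a' b'
      rw [Matrix.of_apply, Matrix.of_apply, sum_unitTensor_eq]
    rw [e]
    exact hM
  -- `(id ⊗ id ⊗ c') ⟨r⟩ = diag (c')` has rank `r`
  have hq : (Matrix.of fun a b => ∑ c, c' c * unitTensor K r a b c).rank = r := by
    have e : (Matrix.of fun a b => ∑ c, c' c * unitTensor K r a b c) = Matrix.diagonal c' := by
      ext a b
      rw [Matrix.of_apply, Finset.sum_eq_single b (fun c _ hc => by simp [Ne.symm hc]) (by simp),
        Matrix.diagonal_apply]
      by_cases hab : a = b
      · subst hab; simp
      · simp [hab]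
    rw [e, Matrix.rank_of_isUnit _ ((Matrix.isUnit_iff_isUnit_det _).2 ?_), Fintype.card_fin]
    rw [Matrix.det_diagonal]
    exact isUnit_iff_ne_zero.2 (Finset.prod_ne_zero_iff.2 fun i _ => hc' i)
  have h := oneFunctional_speedup hT' c' hs
  rw [hq] at h
  exact h

/-- **Thm. 6.1, `λ`-free case, for a rank decomposition indexed by any finite type `σ`**
(`r = |σ|`; e.g. `σ = Fin n → Fin (q+2)` for the Kronecker powers used in Prop. 7.1): reindex along
`σ ≃ Fin |σ|` and apply `thm61_rankDecomposition`. [cite: AlmanLi2026, Thm. 6.1 (rank-decomposition case)] -/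
theorem thm61_rankDecomposition_fintype [Field K] [Fintype ι'] [Fintype κ'] [Fintype μ']
    [DecidableEq ι'] [DecidableEq κ'] [DecidableEq μ'] {σ : Type*} [Fintype σ]
    {T : ι' → κ' → μ' → K} {A : ι' → σ → K} {B : κ' → σ → K} {C₀ : μ' → σ → K}
    (hT : ∀ a' b' c', T a' b' c' = ∑ i, A a' i * B b' i * C₀ c' i)
    {c' : σ → K} (hc' : ∀ i, c' i ≠ 0) {s : ℕ}
    (hM : (Matrix.of fun a' b' => ∑ i, A a' i * B b' i * c' i).rank ≤ s) :
    AlgDegeneratesTo (directSumTensor (unitTensor K (Fintype.card σ))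
        (rotate (oneSliceTensor K (Fin s))))
      (directSumTensor T (rotate (oneSliceTensor K
        (Fin (Fintype.card σ + s - (Fintype.card ι' + Fintype.card κ')))))) := by
  classical
  set e := Fintype.equivFin σ
  have hT' : ∀ a' b' c', T a' b' c' =
      ∑ i : Fin (Fintype.card σ), A a' (e.symm i) * B b' (e.symm i) * C₀ c' (e.symm i) :=
    fun a' b' c' => by
      rw [hT, ← e.symm.sum_comp]
  have hM' : (Matrix.of fun a' b' =>
      ∑ i : Fin (Fintype.card σ), A a' (e.symm i) * B b' (e.symm i) * c' (e.symm i)).rank ≤ s := by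
    have heq : (Matrix.of fun a' b' =>
        ∑ i : Fin (Fintype.card σ), A a' (e.symm i) * B b' (e.symm i) * c' (e.symm i)) =
        Matrix.of fun a' b' => ∑ i, A a' i * B b' i * c' i := by
      ext a' b'
      rw [Matrix.of_apply, Matrix.of_apply, e.symm.sum_comp (fun i => A a' i * B b' i * c' i)]
    rw [heq]
    exact hM
  exact thm61_rankDecomposition hT' (fun i => hc' (e.symm i)) hM'

/-- **Thm. 6.1, `λ`-free case, decomposition indexed by `σ ≃ Fin r`** (the form used for Kronecker
powers, `σ = Fin n → Fin (q+2)`, `r = (q+2)^n`). [cite: AlmanLi2026, Thm. 6.1 (rank-decomposition case)] -/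
theorem thm61_rankDecomposition_equiv [Field K] [Fintype ι'] [Fintype κ'] [Fintype μ']
    [DecidableEq ι'] [DecidableEq κ'] [DecidableEq μ'] {σ : Type*} [Fintype σ] {r : ℕ} (e : σ ≃ Fin r)
    {T : ι' → κ' → μ' → K} {A : ι' → σ → K} {B : κ' → σ → K} {C₀ : μ' → σ → K}
    (hT : ∀ a' b' c', T a' b' c' = ∑ i, A a' i * B b' i * C₀ c' i)
    {c' : σ → K} (hc' : ∀ i, c' i ≠ 0) {s : ℕ}
    (hM : (Matrix.of fun a' b' => ∑ i, A a' i * B b' i * c' i).rank ≤ s) :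
    AlgDegeneratesTo (directSumTensor (unitTensor K r) (rotate (oneSliceTensor K (Fin s))))
      (directSumTensor T (rotate (oneSliceTensor K
        (Fin (r + s - (Fintype.card ι' + Fintype.card κ')))))) := by
  classical
  have hT' : ∀ a' b' c', T a' b' c' =
      ∑ i : Fin r, A a' (e.symm i) * B b' (e.symm i) * C₀ c' (e.symm i) :=
    fun a' b' c' => by
      rw [hT, ← e.symm.sum_comp]
  have hM' : (Matrix.of fun a' b' =>
      ∑ i : Fin r, A a' (e.symm i) * B b' (e.symm i) * c' (e.symm i)).rank ≤ s := by
    have heq : (Matrix.of fun a' b' =>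
        ∑ i : Fin r, A a' (e.symm i) * B b' (e.symm i) * c' (e.symm i)) =
        Matrix.of fun a' b' => ∑ i, A a' i * B b' i * c' i := by
      ext a' b'
      rw [Matrix.of_apply, Matrix.of_apply, e.symm.sum_comp (fun i => A a' i * B b' i * c' i)]
    rw [heq]
    exact hM
  exact thm61_rankDecomposition hT' (fun i => hc' (e.symm i)) hM'

/-! ## The free lunch with one functional (Prop. 5.3 + Thm. 5.1), as invoked in Thms. 6.2 and 7.1 -/

/-- **Alman–Li 2026, Prop. 5.3 with Thm. 5.1 — the free lunch with ONE functional** (the step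
"`f` satisfies the condition of (prop:freelunch_oneslice)" in the proofs of Thm. 6.2 and Thm. 7.1),
for restriction data over a field: let `T = (A ⊗ B ⊗ C) S` with `n = |ι'|` rows of `A` and
`m = |κ'|` rows of `B`, and let `f : μ → K` be a functional with `(A ⊗ B ⊗ f) S = 0` and
`q = rank (id ⊗ id ⊗ f) S` (its fullness index). Then `T ⊕ ⟨1, q − n − m, 1⟩ ⊴ S` — the slice is
appended to the LEFT side only. [cite: AlmanLi2026, Prop. 5.3 with Thm. 5.1 (proofs of Thm. 6.2, 7.1)] -/
theorem freeLunch_oneFunctional [Field K] [Fintype ι] [Fintype κ] [Fintype μ] [Fintype ι']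
    [Fintype κ'] [Fintype μ'] [DecidableEq ι'] [DecidableEq κ'] [DecidableEq μ']
    {S : ι → κ → μ → K} {T : ι' → κ' → μ' → K} {A : ι' → ι → K} {B : κ' → κ → K}
    {C₀ : μ' → μ → K}
    (hT : ∀ a' b' c', T a' b' c' = ∑ a, ∑ b, ∑ c, A a' a * B b' b * C₀ c' c * S a b c)
    (f : μ → K) (hf : ∀ a' b', (∑ a, ∑ b, ∑ c, A a' a * B b' b * f c * S a b c) = 0) :
    AlgDegeneratesTo S
      (directSumTensor T (rotate (oneSliceTensor K
        (Fin ((Matrix.of fun a b => ∑ c, f c * S a b c).rank -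
          (Fintype.card ι' + Fintype.card κ')))))) := by
  classical
  -- Thm. 5.1's annihilators for the data `(A, B, f)`, with bases as rows
  set VA := LinearMap.ker (Matrix.of fun (b' : κ') (x : ι) =>
    ∑ y, ∑ w, B b' y * f w * S x y w).mulVecLin with hVA
  set VB := LinearMap.ker (Matrix.of fun (a' : ι') (y : κ) =>
    ∑ x, ∑ w, A a' x * f w * S x y w).mulVecLin with hVB
  set bA := Module.finBasis K VA
  set bB := Module.finBasis K VB
  set A'' : Fin (Module.finrank K VA) → ι → K := fun x => ((bA x : VA) : ι → K) with hA''
  set B'' : Fin (Module.finrank K VB) → κ → K := fun y => ((bB y : VB) : κ → K) with hB''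
  set T'' : Fin (Module.finrank K VA) → Fin (Module.finrank K VB) → Unit → K :=
    fun x y _ => ∑ a, ∑ b, ∑ c, A'' x a * B'' y b * f c * S a b c with hT''
  have hA''mem : ∀ x b' (z : Unit),
      (∑ a, ∑ b, ∑ c, A'' x a * B b' b * (fun _ : Unit => f) z c * S a b c) = 0 := by
    intro x b' z
    exact (mem_ker_annihilatorA_iff S B f (A'' x)).1 (bA x).2 b'
  have hB''mem : ∀ a' y (z : Unit),
      (∑ a, ∑ b, ∑ c, A a' a * B'' y b * (fun _ : Unit => f) z c * S a b c) = 0 := by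
    intro a' y z
    exact (mem_ker_annihilatorB_iff S A f (B'' y)).1 (bB y).2 a'
  have hA''span : ∀ u : ι → K,
      (∀ b', (∑ a, ∑ b, ∑ c, u a * B b' b * f c * S a b c) = 0) →
        u ∈ Submodule.span K (Set.range A'') := by
    intro u hu
    have hmem : u ∈ VA := (mem_ker_annihilatorA_iff S B f u).2 hu
    have hspan : Submodule.span K (Set.range A'') = VA := by
      have h := congrArg (Submodule.map VA.subtype) bA.span_eq
      rwa [Submodule.map_span, ← Set.range_comp, Submodule.map_subtype_top] at h
    rw [hspan]
    exact hmem
  have hB''span : ∀ v : κ → K,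
      (∀ a', (∑ a, ∑ b, ∑ c, A a' a * v b * f c * S a b c) = 0) →
        v ∈ Submodule.span K (Set.range B'') := by
    intro v hv
    have hmem : v ∈ VB := (mem_ker_annihilatorB_iff S A f v).2 hv
    have hspan : Submodule.span K (Set.range B'') = VB := by
      have h := congrArg (Submodule.map VB.subtype) bB.span_eq
      rwa [Submodule.map_span, ← Set.range_comp, Submodule.map_subtype_top] at h
    rw [hspan]
    exact hmem
  -- Thm. 5.1: `T ⊕ T'' ⊴ S`
  have hdeg : AlgDegeneratesTo S (directSumTensor T T'') :=
    thm51 (A := A) (B := B) (C₀ := C₀) (C' := fun _ : Unit => f) hT (fun x y z => by rw [hT''])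
      (fun a' b' _ => hf a' b') hA''mem hB''mem
  -- Prop. 5.3: the matrix of `T''` has rank `t ≥ q − n − m`, and `T'' ≥ ⟨1,t,1⟩ ≥ ⟨1, q−n−m, 1⟩`
  have hrank := prop53_rank (T' := T'') (fun x y z => by rw [hT'']) hA''span hB''span
  have hslice := (restrictsTo_oneSlice_of_flattening_rank_eq T'' rfl).trans
    (tensorRestrictsTo_rotate_oneSliceTensor_of_le (K := K)
      (t := (Matrix.of fun x y => T'' x y ()).rank)
      (t₀ := (Matrix.of fun a b => ∑ c, f c * S a b c).rank -
        (Fintype.card ι' + Fintype.card κ')) (by omega))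
  exact hdeg.trans_restrictsTo ((TensorRestrictsTo.refl T).directSum hslice)

end AlmanLi2026

end Literature.Computability.AlgebraicComplexity
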